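-- PORT-REPAIR carch-1-g56 2026-08-21T20:32Z: layer 1, not yet emitted; its replayed scope prelude carried the same macro (line 14) — the RUN-81 source's file-local tactic macro `cplx_ring` (5-line block) DELETED and its 1 use(s) on 1 line(s) INLINED with the per-site pruned tactic (carch-1 g54/g55 rendering, hub 0 warnings); nothing else changed: line 1, imports, docstrings, statements byte-identical to port/staging.
import Summits.HodgeConjecture.HodgeCM.Model.ArchUnitaryDetChar_1

/-! PORT of `HodgeCM/Model/ArchUnitaryDetChar.lean` (HodgeCMPerL run 81) — part 2: continuation of `Summits.HodgeConjecture.HodgeCM.Model.ArchUnitaryDetChar_1` (split at a top-level declaration boundary by port_pkg.py; scope re-opened below; declarations unchanged). -/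

-- port_pkg: scope re-opened for this part (file-level context, then the namespace/section stack open at the cut)
set_option autoImplicit false
noncomputable section
open scoped Matrix
open ComplexConjugate Complex
namespace HodgeCM.Model.U3Char
open HodgeCM.Model.U21Char (diag2U coe_diag2U rotU coe_rotU cayU coe_cayU rotU_mul_cayU unitOf coe_unitOf detU coe_detU diagInl coe_diagInl
  conj_mul_self_of_unitary conj_det_mul_self circleToUnitary coe_circleToUnitary unitaryToCircle circleToUnitary_unitaryToCircle norm_coe_unitary)
open Literature.Geometry.ComplexHyperbolic.BallModel (su2Mat su2Mat_mem)
/-- **Givens factorisation**: two plane rotations clear the first column of any `u ∈ U(3)`: `k₂ k₁ u = 1 ⊕ B`. -/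
theorem exists_inl01_mul_inr12_mul_eq_inr12 (u : Matrix.unitaryGroup (Fin 3) ℂ) :
    ∃ k₁ k₂ B : Matrix.unitaryGroup (Fin 2) ℂ, inl01 k₂ * inr12 k₁ * u = inr12 B := by
  -- the first column
  obtain ⟨c₀, c₁, c₂, h0, h1, h2⟩ : ∃ c₀ c₁ c₂ : ℂ, (u : Matrix (Fin 3) (Fin 3) ℂ) 0 0 = c₀ ∧ (u : Matrix (Fin 3) (Fin 3) ℂ) 1 0 = c₁ ∧
      (u : Matrix (Fin 3) (Fin 3) ℂ) 2 0 = c₂ := ⟨_, _, _, rfl, rfl, rfl⟩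
  have hcol : conj c₀ * c₀ + conj c₁ * c₁ + conj c₂ * c₂ = 1 := by
    have h := congrFun (congrFun (Matrix.mem_unitaryGroup_iff'.mp u.2) 0) 0
    simp [Matrix.mul_apply, Fin.sum_univ_three, Matrix.star_apply, h0, h1, h2] at h
    linear_combination h
  -- the first rotation, in the `(1,2)`-plane: `(c₁, c₂) ↦ (r, 0)`
  set r : ℝ := Real.sqrt (‖c₁‖ ^ 2 + ‖c₂‖ ^ 2) with hr_def
  have hr0 : 0 ≤ r := Real.sqrt_nonneg _
  have hr2 : (r : ℂ) ^ 2 = conj c₁ * c₁ + conj c₂ * c₂ := by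
    rw [Complex.conj_mul', Complex.conj_mul', ← Complex.ofReal_pow, hr_def, Real.sq_sqrt (by positivity)]
    push_cast; ring
  obtain ⟨k₁, hk₁⟩ : ∃ k₁ : Matrix.unitaryGroup (Fin 2) ℂ,
      (∀ i : Fin 3, ((inr12 k₁ * u : Matrix.unitaryGroup (Fin 3) ℂ) : Matrix (Fin 3) (Fin 3) ℂ) i 0 = ![c₀, (r : ℂ), 0] i) := by
    by_cases hr : r = 0
    · have hc12 : ‖c₁‖ ^ 2 + ‖c₂‖ ^ 2 = 0 := by
        rwa [hr_def, Real.sqrt_eq_zero (by positivity)] at hr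
      have hc1 : c₁ = 0 := by
        have : ‖c₁‖ ^ 2 = 0 := by nlinarith [sq_nonneg ‖c₁‖, sq_nonneg ‖c₂‖]
        simpa using this
      have hc2 : c₂ = 0 := by
        have : ‖c₂‖ ^ 2 = 0 := by nlinarith [sq_nonneg ‖c₁‖, sq_nonneg ‖c₂‖]
        simpa using this
      refine ⟨1, fun i => ?_⟩
      rw [map_one, one_mul]
      fin_cases i
      · simpa using h0
      · simpa [hr] using h1.trans hc1
      · simpa using h2.trans hc2
    · have hrC : (r : ℂ) ≠ 0 := by exact_mod_cast hr
      have hk : conj (conj c₁ / r) * (conj c₁ / r) + conj (-c₂ / r) * (-c₂ / r) = 1 := by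
        rw [map_div₀, map_div₀, conj_conj, Complex.conj_ofReal, map_neg]
        field_simp
        linear_combination (norm := skip) (-1 : ℂ) * hr2
        (ring1)
      refine ⟨su2U _ _ hk, fun i => ?_⟩
      change ((inr12Mat (su2Mat (conj c₁ / r) (-c₂ / r))) * (u : Matrix (Fin 3) (Fin 3) ℂ)) i 0 = _
      fin_cases i <;> simp [Matrix.mul_apply, Fin.sum_univ_three, inr12Mat, su2Mat, h0, h1, h2]
      · field_simp
        linear_combination (-1 : ℂ) * hr2
      · field_simp
        ring
  -- after the first rotation the column is `(c₀, r, 0)` with `c̄₀ c₀ + r² = 1`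
  have hcol' : conj c₀ * c₀ + (r : ℂ) * r = 1 := by rw [← hcol, ← pow_two, hr2]; ring
  have hk₂mem : conj (conj c₀) * conj c₀ + conj (-(r : ℂ)) * (-(r : ℂ)) = 1 := by
    rw [conj_conj, map_neg, Complex.conj_ofReal, mul_comm c₀, neg_mul_neg, hcol']
  set v := inr12 k₁ * u with hv_def
  have hv0 : (v : Matrix (Fin 3) (Fin 3) ℂ) 0 0 = c₀ := by simpa using hk₁ 0
  have hv1 : (v : Matrix (Fin 3) (Fin 3) ℂ) 1 0 = r := by simpa using hk₁ 1
  have hv2 : (v : Matrix (Fin 3) (Fin 3) ℂ) 2 0 = 0 := by simpa using hk₁ 2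
  set w := inl01 (su2U _ _ hk₂mem) * v with hw_def
  have hw00 : (w : Matrix (Fin 3) (Fin 3) ℂ) 0 0 = 1 := by
    change ((inl01Mat (su2Mat (conj c₀) (-(r : ℂ)))) * (v : Matrix (Fin 3) (Fin 3) ℂ)) 0 0 = 1
    simp [Matrix.mul_apply, Fin.sum_univ_three, inl01Mat, su2Mat, hv0, hv1, hv2, Complex.conj_ofReal]
    linear_combination hcol'
  have hw10 : (w : Matrix (Fin 3) (Fin 3) ℂ) 1 0 = 0 := by
    change ((inl01Mat (su2Mat (conj c₀) (-(r : ℂ)))) * (v : Matrix (Fin 3) (Fin 3) ℂ)) 1 0 = 0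
    simp [Matrix.mul_apply, Fin.sum_univ_three, inl01Mat, su2Mat, hv0, hv1, hv2]
    ring
  have hw20 : (w : Matrix (Fin 3) (Fin 3) ℂ) 2 0 = 0 := by
    change ((inl01Mat (su2Mat (conj c₀) (-(r : ℂ)))) * (v : Matrix (Fin 3) (Fin 3) ℂ)) 2 0 = 0
    simp [Matrix.mul_apply, Fin.sum_univ_three, inl01Mat, su2Mat, hv0, hv1, hv2]
  obtain ⟨B, hB⟩ := exists_eq_inr12 w hw00 hw10 hw20
  exact ⟨k₁, su2U _ _ hk₂mem, B, by rw [← hB, hw_def, hv_def, mul_assoc]⟩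

section U3

variable {M : Type*} [CommGroup M] (χ : Matrix.unitaryGroup (Fin 3) ℂ →* M)

/-- (Ported verbatim from the HodgeCMPerL package; no docstring in the source.) -/
theorem map_inl01 (A : Matrix.unitaryGroup (Fin 2) ℂ) : χ (inl01 A) = χ (D3 (detU A)) := by
  have h := map_eq_map_diagInl (χ.comp inl01) A
  simpa [D3] using h

/-- (Ported verbatim from the HodgeCMPerL package; no docstring in the source.) -/
theorem map_inr12 (A : Matrix.unitaryGroup (Fin 2) ℂ) : χ (inr12 A) = χ (D3 (detU A)) := by
  have h := map_eq_map_diagInl (χ.comp inr12) A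
  simp only [MonoidHom.comp_apply] at h
  rw [h]
  -- `diag(1, w, 1) = (diag(w̄, w) ⊕ 1) · diag(w, 1, 1)`
  set w := detU A
  have hw : conj ((w : ℂ)) * w = 1 := conj_mul_self_of_unitary w
  have hw' : conj (conj (w : ℂ)) * conj (w : ℂ) = 1 := by rw [conj_conj, mul_comm, hw]
  have e : inr12 (diagInl w) = inl01 (diag2U (conj (w : ℂ)) w hw' hw) * D3 w := U3_eq_of_coe_eq (by
    rw [coe_inr12, coe_diagInl, Submonoid.coe_mul, coe_inl01, coe_diag2U, coe_D3]
    ext i j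
    fin_cases i <;> fin_cases j <;> simp [inr12Mat, inl01Mat, Matrix.mul_apply, Fin.sum_univ_three, hw])
  rw [e, map_mul, ← MonoidHom.comp_apply χ inl01, map_diag2U_eq_one (χ.comp inl01) _ _ hw' hw (by rw [hw]), one_mul]

/-- **on `U(3)` every abelian character is a function of `det`: `χ u = χ (diag(det u, 1, 1))`.** -/
theorem map_eq_map_D3 (u : Matrix.unitaryGroup (Fin 3) ℂ) : χ u = χ (D3 (det3U u)) := by
  obtain ⟨k₁, k₂, B, e⟩ := exists_inl01_mul_inr12_mul_eq_inr12 u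
  have hu : u = (inr12 k₁)⁻¹ * ((inl01 k₂)⁻¹ * inr12 B) := by
    rw [← e, mul_assoc (inl01 k₂), inv_mul_cancel_left, inv_mul_cancel_left]
  have hdet : det3U u = (detU k₁)⁻¹ * ((detU k₂)⁻¹ * detU B) := by
    conv_lhs => rw [hu]
    rw [map_mul, map_mul, map_inv, map_inv, det3U_inr12, det3U_inl01, det3U_inr12]
  rw [hdet, map_mul, map_mul, map_inv, map_inv]
  conv_lhs => rw [hu]
  rw [map_mul, map_mul, map_inv, map_inv, map_inr12, map_inl01, map_inr12, map_mul, map_mul, map_inv, map_inv]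

end U3

/-- `z ↦ diag(z, 1, 1)` is continuous on the circle. -/
theorem continuous_D3_circle : Continuous fun z : Circle => D3 (circleToUnitary z) := by
  refine Continuous.subtype_mk ?_ _
  have h : (fun z : Circle => inl01Mat ((diagInl (circleToUnitary z) : Matrix.unitaryGroup (Fin 2) ℂ) : Matrix (Fin 2) (Fin 2) ℂ)) =
      fun z : Circle => !![(z : ℂ), 0, 0; 0, 1, 0; 0, 0, 1] := by
    funext z
    rw [← coe_circleToUnitary z, ← coe_D3]
    rfl
  change Continuous fun z : Circle => inl01Mat ((diagInl (circleToUnitary z) : Matrix.unitaryGroup (Fin 2) ℂ) : Matrix (Fin 2) (Fin 2) ℂ)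
  rw [h]
  refine continuous_matrix fun i j => ?_
  fin_cases i <;> fin_cases j <;> simp <;> first | exact continuous_const | exact continuous_subtype_val

/-- **With continuity along `z ↦ diag(z, 1, 1)`, an abelian character of `U(3)` is `det^m`** for ONE integer `m`
([BröckerTomDieck1985, II (8.1)] through the twin `CircleChar.existsUnique_zpow_complex`). -/
theorem exists_zpow_of_continuous3 (χ : Matrix.unitaryGroup (Fin 3) ℂ →* ℂˣ)
    (hχ : Continuous fun z : Circle => ((χ (D3 (circleToUnitary z)) : ℂˣ) : ℂ)) :
    ∃ m : ℤ, ∀ u : Matrix.unitaryGroup (Fin 3) ℂ, ((χ u : ℂˣ) : ℂ) = (u : Matrix (Fin 3) (Fin 3) ℂ).det ^ m := by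
  let f : Circle →* ℂ := (Units.coeHom ℂ).comp ((χ.comp D3).comp circleToUnitary)
  have hf : Continuous f := hχ
  obtain ⟨n, hn, -⟩ := Literature.RepresentationTheory.CompactGroups.CircleChar.existsUnique_zpow_complex f hf
  refine ⟨n, fun u => ?_⟩
  rw [map_eq_map_D3, ← circleToUnitary_unitaryToCircle (det3U u)]
  exact hn (unitaryToCircle (det3U u))

end HodgeCM.Model.U3Char

end
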